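import Literature.Computability.Complexity.NTIMEMono
import HarnessLib

/-!
# Normalising an `NTIME f` verifier into a total, everywhere-fast verifier

Literature / complexity toolkit (the verifier fed to the universal simulation of the
nondeterministic time hierarchy theorem, `NTIMEHierarchyDiagonal.lean`). The tree's `NTIME f`
(`Nondeterministic.lean`) gives a relation `R`, a constant `c` and a machine `M` that is only
promised to be fast on pairs `⟨x, y⟩` with `|y| ≤ c f|x| + c`, and membership
`x ∈ L ↔ ∃ y, |y| ≤ c f|x| + c ∧ R x y`. For time-constructible `f` this is re-packaged
(**`exists_normalVerifier`**) into a relation `R' x y = R x (y ↾ (c f|x| + c))` and a machine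
`M'` such that

* `M'` is TOTAL and fast EVERYWHERE: on every pair word `⟨x, y⟩` it outputs `[R' x y]` within
  `a (f|x| + |y|) + a` steps;
* `x ∈ L ↔ ∃ y, R' x y` — no length side condition — and accepted witnesses can be shortened
  into the range `|y| ≤ c f|x| + c`.

This is exactly the construction of `NTIME_mono_holds` in `NTIMEMono.lean` (the truncating
wrapper `truncMapAux N ∘ M` of `TruncMapMachine.lean` around the unary clock
`x ↦ ⟨x, 1^{c f|x| + c}⟩` of `NTIMEHierarchyClock.lean` for the time-constructible bound
`n ↦ c f n + c`, `IsTimeConstructible.mul_add`; `c ≥ 1` by `not_outputsWithin_zero`), with the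
everywhere time bound stated explicitly instead of only on admissible pairs.

## References

* S. Arora, B. Barak, *Computational Complexity: A Modern Approach*, CUP 2009, Thm. 2.6
  (§2.1.2), Def. 2.1.
-/

namespace Literature.Computability.Complexity

open _root_.Computability Turing

/-- **Normalisation of an `NTIME f` verifier** (`f` time constructible): from the two clauses of
`L ∈ NTIME f` for `(c, R, M)`, a relation `R' x y = R x (y ↾ (c f|x| + c))` and a machine `M'`
with: (1) `M'` outputs `[R' x y]` on EVERY pair word `⟨x, y⟩` within `a (f|x| + |y|) + a` steps;
(2) `x ∈ L ↔ ∃ y, R' x y = true`; (3) accepted witnesses shorten into the range `c f|x| + c`.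
`M'` is `truncMapAux` of the clock of `n ↦ c f n + c` composed with `M`, as in
`NTIME_mono_holds`. [cite: AroraBarakCC2009, Thm. 2.6 (§2.1.2)] -/
theorem exists_normalVerifier {f : ℕ → ℕ} (hf : IsTimeConstructible f) {L : Language Bool} {c : ℕ}
    {R : List Bool → List Bool → Bool} {M : TM2ComputableAux Bool Bool}
    (hM : ∀ x y : List Bool, y.length ≤ c * f x.length + c →
      M.OutputsWithin (boolPair x y) (encodeBool (R x y)) (c * f x.length + c))
    (hL : ∀ x : List Bool, x ∈ L ↔ ∃ y : List Bool, y.length ≤ c * f x.length + c ∧ R x y = true) :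
    ∃ (R' : List Bool → List Bool → Bool) (M' : TM2ComputableAux Bool Bool) (a : ℕ),
      (∀ x y : List Bool, M'.OutputsWithin (boolPair x y) (encodeBool (R' x y)) (a * (f x.length + y.length) + a)) ∧
      (∀ x : List Bool, x ∈ L ↔ ∃ y : List Bool, R' x y = true) ∧
      (∀ x y : List Bool, R' x y = true →
        (y.take (c * f x.length + c)).length ≤ c * f x.length + c ∧ R' x (y.take (c * f x.length + c)) = true) := by
  rcases Nat.eq_zero_or_pos c with rfl | hc
  · -- `c = 0`: the presentation would answer on `⟨ε, ε⟩` within `0` steps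
    exact (not_outputsWithin_zero M _ _ (by simpa using hM [] [] (by simp))).elim
  obtain ⟨N, aN, hN⟩ := exists_unaryClock_of_timeConstructible (hf.mul_add hc)
  refine ⟨fun x y => R x (y.take (c * f x.length + c)), (truncMapAux N).comp M, aN * c + 2 * aN + 6 * c + 12,
    fun x y => ?_, fun x => ?_, fun x y h => ?_⟩
  · have h₁ := outputsWithin_truncMapAux_boolPair N (y := y) (hN x)
    simp only [List.length_replicate] at h₁
    have h₂ := hM x (y.take (c * f x.length + c)) (by simp)
    have h := Turing.TM2ComputableAux.comp_outputsWithin _ _ h₁ h₂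
    refine h.mono ?_
    have hn := hf.1 x.length
    have hdiv : y.length / 2 ≤ y.length := Nat.div_le_self _ _
    -- name the products and reduce to linear arithmetic
    generalize hF : f x.length = F at *
    generalize hY : y.length = Y at *
    have e1 : aN * (c * F + c) = aN * c * F + aN * c := by ring
    have e2 : (aN * c + 2 * aN + 6 * c + 12) * (F + Y) + (aN * c + 2 * aN + 6 * c + 12) =
        aN * c * F + 2 * (aN * F) + 6 * (c * F) + 12 * F + (aN * c * Y + 2 * (aN * Y) + 6 * (c * Y) + 12 * Y) +
          (aN * c + 2 * aN + 6 * c + 12) := by ring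
    rw [e1] at h ⊢
    rw [e2]
    have g1 : F ≤ c * F := Nat.le_mul_of_pos_left F hc
    have g2 := Nat.zero_le (aN * F)
    have g3 := Nat.zero_le (aN * c * Y)
    have g4 := Nat.zero_le (aN * Y)
    have g5 := Nat.zero_le (c * Y)
    omega
  · rw [hL x]
    constructor
    · rintro ⟨y, hy, hR⟩
      exact ⟨y, by simpa [List.take_of_length_le hy] using hR⟩
    · rintro ⟨y, hR⟩
      exact ⟨y.take (c * f x.length + c), by simp, hR⟩
  · refine ⟨by simp, ?_⟩
    simpa [List.take_take] using h

end Literature.Computability.Complexity
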